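import Mathlib
import Summits.ValiantsHypothesis.ValiantsHypothesis.Theorems.RigidityForcesSymmetryRankRigidMinimalReprLaplaceFiveSeparatedCaptureLinesK1
import Summits.ValiantsHypothesis.ValiantsHypothesis.Theorems.RigidityForcesSymmetryRankRigidMinimalReprLaplaceFiveSeparatedCaptureDisjointPairFour

/-!
# ValiantsHypothesis / RigidityForcesSymmetry — crux `LaplaceOptimalFive` (stmt-ValiantsHypothesis-24813), young-shadow K1:
# **K1 ON `K₃ ⊔ K₂` FOR A DISJOINT PAIR OF TRIANGLE SPANS OF TOTAL DIMENSION ≤ 4** (third cut `≤ 2`)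

K1 consumer of ✓ `captureIneqSym_of_disjoint_pair_four` (val-port-2 g5: the symmetric capture inequality for a DISJOINT pair of
triangle spans `U ⊓ U′ = ⊥` with `dim U + dim U′ ≤ 4` and a third span of dimension `≤ 2`, via the prolongation bounds
✓ `finrank_prolong_le_four/five`) through the local bridge ✓ `sideSym_K32canon_of_captureAt` (`…K1Bridge.lean`), extending
✓ `sideSym_K32canon_disjoint_pair` (total dimension `≤ 3`) verbatim in shape: a side-symmetric split decomposition of `P₅` on
`{01, 02, 12, 34}` two of whose triangle short spans are disjoint of total dimension `≤ 4`, the third of dimension `≤ 2`, has Laplace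
weight `≥ 5! = 120` — in all three placements of the disjoint pair (rôle symmetry ✓ `contractZ_mem_L3_swap23/13`).  New profiles over
✓ `…DisjointPairK1`: `(2,2,≤2)`, `(1,3,≤2)`, `(3,1,≤2)`, `(0,4,≤2)` (disjoint), in each placement.

* ★★ `sideSym_K32canon_disjoint_pair_four` — disjoint pair on the cuts `{0,1}, {0,2}`;  ★ `…_four01_12`, ★ `…_four02_12` — the other two.

Honest framing.  A SUB-CASE of K1 on `K₃ ⊔ K₂`; disjoint pairs of total dimension `≥ 5`, intersecting pairs beyond two lines, K1 on
`K₃ ⊔ K₂` in general, `CaptureIneqSym`, S2′, `LaplaceOptimalFive` (OPEN · CONTESTED 72/120), `RankRigidMinimalRepr`, `VP ≠ VNP` are NOT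
proved.  No definitions, no `sorry`.
-/

set_option linter.dupNamespace false
set_option autoImplicit false

namespace Summit.ValiantsHypothesis.ValiantsHypothesis.Theorems.RigidityForcesSymmetryRankRigidMinimalRepr

namespace LaplaceFiveSeparatedCapture

open Finset LaplaceFiveSectorSplit

/-- ★★ **K1 ON `K₃ ⊔ K₂ = {01, 02, 12, 34}` FOR DISJOINT SPANS ON `{0,1}`, `{0,2}` OF TOTAL DIMENSION `≤ 4`** (the span on `{1,2}`
of dimension `≤ 2`). [folklore] -/
theorem sideSym_K32canon_disjoint_pair_four {N : ℕ} (T : Finset (Fin N)) (S : Fin N → Finset (Fin 5))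
    (u w : Fin N → (Fin 5 → Fin 5) → ℂ) (hdec : IsSplitDecomposition T S u w) (hsym : SideSymmetric T S u w)
    (hC : ∀ t ∈ T, S t = ({0, 1} : Finset (Fin 5)) ∨ S t = ({0, 2} : Finset (Fin 5)) ∨
      S t = ({1, 2} : Finset (Fin 5)) ∨ S t = ({3, 4} : Finset (Fin 5)))
    (hdis : shortSpan T S u 0 1 ⊓ shortSpan T S u 0 2 = ⊥)
    (h4 : Module.finrank ℂ (shortSpan T S u 0 1) + Module.finrank ℂ (shortSpan T S u 0 2) ≤ 4)
    (h12 : Module.finrank ℂ (shortSpan T S u 1 2) ≤ 2) :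
    Nat.factorial 5 ≤ laplaceWeight T S :=
  sideSym_K32canon_of_captureAt T S u w hdec hsym hC fun hs01 hs02 hs12 W hWs hWd hWc =>
    captureIneqSym_of_disjoint_pair_four _ _ _ W hs01 hs02 hs12 hdis h4 h12 hWs hWd hWc

/-- ★ **Disjoint pair of total dimension `≤ 4` on the cuts `{0,1}`, `{1,2}`** (the span on `{0,2}` of dimension `≤ 2`), by the
rôle symmetry ✓ `contractZ_mem_L3_swap23`. [folklore] -/
theorem sideSym_K32canon_disjoint_pair_four01_12 {N : ℕ} (T : Finset (Fin N)) (S : Fin N → Finset (Fin 5))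
    (u w : Fin N → (Fin 5 → Fin 5) → ℂ) (hdec : IsSplitDecomposition T S u w) (hsym : SideSymmetric T S u w)
    (hC : ∀ t ∈ T, S t = ({0, 1} : Finset (Fin 5)) ∨ S t = ({0, 2} : Finset (Fin 5)) ∨
      S t = ({1, 2} : Finset (Fin 5)) ∨ S t = ({3, 4} : Finset (Fin 5)))
    (hdis : shortSpan T S u 0 1 ⊓ shortSpan T S u 1 2 = ⊥)
    (h4 : Module.finrank ℂ (shortSpan T S u 0 1) + Module.finrank ℂ (shortSpan T S u 1 2) ≤ 4)
    (h02 : Module.finrank ℂ (shortSpan T S u 0 2) ≤ 2) :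
    Nat.factorial 5 ≤ laplaceWeight T S := by
  refine sideSym_K32canon_of_captureAt T S u w hdec hsym hC fun hs01 hs02 hs12 W hWs hWd hWc => ?_
  have hWc' : ∀ μ ∈ W, contractZ μ ∈ L3 (shortSpan T S u 0 1) (shortSpan T S u 1 2) (shortSpan T S u 0 2) :=
    fun μ hμ => contractZ_mem_L3_swap23 _ _ _ hs01 μ (hWc μ hμ)
  have h := captureIneqSym_of_disjoint_pair_four _ _ _ W hs01 hs12 hs02 hdis h4 h02 hWs hWd hWc'
  omega

/-- ★ **Disjoint pair of total dimension `≤ 4` on the cuts `{1,2}`, `{0,2}`** (the span on `{0,1}` of dimension `≤ 2`), by the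
rôle symmetry ✓ `contractZ_mem_L3_swap13`. [folklore] -/
theorem sideSym_K32canon_disjoint_pair_four02_12 {N : ℕ} (T : Finset (Fin N)) (S : Fin N → Finset (Fin 5))
    (u w : Fin N → (Fin 5 → Fin 5) → ℂ) (hdec : IsSplitDecomposition T S u w) (hsym : SideSymmetric T S u w)
    (hC : ∀ t ∈ T, S t = ({0, 1} : Finset (Fin 5)) ∨ S t = ({0, 2} : Finset (Fin 5)) ∨
      S t = ({1, 2} : Finset (Fin 5)) ∨ S t = ({3, 4} : Finset (Fin 5)))
    (hdis : shortSpan T S u 1 2 ⊓ shortSpan T S u 0 2 = ⊥)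
    (h4 : Module.finrank ℂ (shortSpan T S u 1 2) + Module.finrank ℂ (shortSpan T S u 0 2) ≤ 4)
    (h01 : Module.finrank ℂ (shortSpan T S u 0 1) ≤ 2) :
    Nat.factorial 5 ≤ laplaceWeight T S := by
  refine sideSym_K32canon_of_captureAt T S u w hdec hsym hC fun hs01 hs02 hs12 W hWs hWd hWc => ?_
  have hWc' : ∀ μ ∈ W, contractZ μ ∈ L3 (shortSpan T S u 1 2) (shortSpan T S u 0 2) (shortSpan T S u 0 1) :=
    fun μ hμ => contractZ_mem_L3_swap13 _ _ _ hs01 hs02 hs12 μ (hWc μ hμ)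
  have h := captureIneqSym_of_disjoint_pair_four _ _ _ W hs12 hs02 hs01 hdis h4 h01 hWs hWd hWc'
  omega

end LaplaceFiveSeparatedCapture

end Summit.ValiantsHypothesis.ValiantsHypothesis.Theorems.RigidityForcesSymmetryRankRigidMinimalRepr
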